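/-
Copyright (c) 2026 the pub-hodgecm-mathlib formalisation cell (harness21).  Prover seat hodgecm-mathlib-F0P3a-p02 (g17): road «S3-ram» (LEAD F0P3a-plan (g12);
architect A-p16 (g31); junction pen F0P3a-p01 (g17), J-PACK v2 (f) isoceles wave), ENGINE ED. 3 companion «LAYERS OF THE ROOT REGION» (ROW-AX-CNT); 2026-09-02.
-/
import Literature.NumberTheory.Rogawski1990.DepthZeroKappaTransferTypeOneRamifiedRootRegionInduction   -- ★ p847420 (this seat): region bookkeeping (grandchildren, DESCENT, CLOSURE)
import HarnessLib

/-!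
# The ramified type-(1) `κ`-orbital integral: the LAYERS of a root region by distance from the root, and its cardinality from the per-vertex branching numbers
# (Serre, *Trees* I.2.3; Kottwitz 1986 §3; Rogawski 1990 §4.9)

Topic `NumberTheory/Rogawski1990`; namespace `Literature.NumberTheory.Rogawski1990`.  THEOREMS ONLY (no definition, no instance, no notation, no named fact, no `sorry`); kernel
lane `--supports stmt-HodgeConjecture-24833`; imports ★ ENGINE ED. 3 `DepthZeroKappaTransferTypeOneRamifiedRootRegionInduction` only — GENERIC rooted tree, no lattice token.
Cell `pub/hodgecm-mathlib` (D-0151), crux H413; road «S3-ram» (count-neutral), P-1-ram organ A′ (ii) (a2), junction J-PACK v2 (F0P3a-p01 (g17)) deal (f) «ISOCELES wave»,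
row ROW-AX-CNT of the hand's proposal `F0/P3a/F0P3a-p02/g17/iso/ISO-ROWS-proposal.v1…md`: the assembly over a root region `R` (★ `strataVec_total_eq_of_localLaw_of_rootRegion
{,_of_labels}`) needs `#R` and the number of region vertices of each TYPE; in the isoceles configuration the types are read off the distance from the root (ROOT `0`, INTERIOR
`0 < dist < 2s`, END `dist = 2s`) and the per-vertex law gives the number of REGION grandchildren (ROOT `2q`, INTERIOR `q`, END none — B-p14 (g39) CENSUS-G6-axis §0).
THIS FILE turns such per-vertex branching numbers into the layer sizes and the total, for ANY region in the setting of ★ ENGINE ED. 3 (tree `G`, root `r`, finite parent-closed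
`F`, alternating `SD`, grandchildren binder `GC` with `hGC`, region `R` with `r ∈ R ⊆ F`, `SD` on `R`, closed under fixed self-dual GC-parents `hRup`).

* §1 `exists_gcParent_of_mem_region` (every region vertex `v ≠ r` is a grandchild of a region vertex two levels up), `even_dist_of_mem_region`, `eq_root_of_mem_region_of_dist_eq_zero`.
* §2 **`ncard_regionLayer_succ_eq_finsum`**: `#{v ∈ R | dist r v = 2j+2} = Σ_{g ∈ R, dist r g = 2j} #(GC g ∩ R)` (the region grandchildren of distinct region vertices are disjoint).
* §3 **`ncard_regionLayer_eq_of_branching`**, **`ncard_region_eq_of_branching`**: if the root has `b₀` region grandchildren and every region vertex `v ≠ r` with `dist r v < 2s` has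
  `b` of them, and `dist r v ≤ 2s` on `R`, then `#{v ∈ R | dist r v = 2j} = b₀·b^{j−1}` (`1 ≤ j ≤ s`) and **`#R = 1 + b₀·Σ_{i<s} bⁱ`** (isoceles axis: `b₀ = 2q`, `b = q`:
  `#R = 1 + 2q + 2q² + ⋯ + 2q^s`, `#END = 2q^s` — the `A` of ★ `kappaSum_isoceles_shared_pool`).
HONEST LABEL: HC_CM is proved only modulo the 2 remaining named inputs (hLiu418 24832, h413 24833) until rung 0 closes; nothing printed is asserted here (rooted-tree bookkeeping).

## References
* [Serre1980Trees] J.-P. Serre, *Trees* (1980), I.2.3 (spheres and balls in a tree; counting by layers).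
* [Kottwitz1986] R. E. Kottwitz, *Base change for unit elements of Hecke algebras*, Compositio Math. 60 (1986), §3 (counting fixed lattices shell by shell).
* [Rogawski1990] J. D. Rogawski, *Automorphic Representations of Unitary Groups in Three Variables*, Ann. of Math. Stud. 123 (1990), §4.9 pp. 54–56.
-/

set_option autoImplicit false

open Finset SimpleGraph
open Literature.Combinatorics.SimpleGraph.TreeLayers

namespace Literature.NumberTheory.Rogawski1990

variable {V : Type*} {G : SimpleGraph V}

/-! ## §1 The region as a GC-forest rooted at `r` -/

/-- **Every region vertex other than the root is a fixed grandchild of a region vertex two levels up** (its grandparent in the rooted tree: fixed because `F` is parent-closed,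
self-dual by alternation, in the region by `hRup`). [cite: Serre1980Trees, I.2.3] [cite: Kottwitz1986, §3] -/
theorem exists_gcParent_of_mem_region (hT : G.IsTree) (r : V) (F : Set V)
    (hF : ∀ w ∈ F, w ≠ r → ∀ u, G.Adj w u → G.dist r u + 1 = G.dist r w → u ∈ F) (SD : V → Prop)
    (hSD₁ : ∀ v c, G.Adj v c → SD v → ¬ SD c) (hSD₂ : ∀ c w, G.Adj c w → ¬ SD c → SD w) (GC : V → Set V)
    (hGC : ∀ v w, w ∈ GC v ↔ ∃ c, (G.Adj v c ∧ G.dist r c = G.dist r v + 1 ∧ c ∈ F) ∧ (G.Adj c w ∧ G.dist r w = G.dist r c + 1 ∧ w ∈ F))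
    (R : Set V) (hrR : r ∈ R) (hRF : R ⊆ F) (hRS : ∀ v ∈ R, SD v) (hRup : ∀ v ∈ F, SD v → ∀ w ∈ GC v, w ∈ R → v ∈ R)
    {v : V} (hvR : v ∈ R) (hvr : v ≠ r) :
    ∃ g ∈ R, v ∈ GC g ∧ G.dist r v = G.dist r g + 2 := by
  obtain ⟨p, hp, -, -, -⟩ := exists_rooted_parent hT r
  obtain ⟨hvp, hdp⟩ := hp v hvr
  -- the parent `p v` is not self-dual, hence not the root; its parent `g` is fixed, self-dual, and `v ∈ GC g`
  have hpS : ¬ SD (p v) := hSD₁ v (p v) hvp (hRS v hvR)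
  have hpr : p v ≠ r := fun h => hpS (h ▸ hRS r hrR)
  obtain ⟨hpg, hdg⟩ := hp (p v) hpr
  have hpF : p v ∈ F := hF v (hRF hvR) hvr (p v) hvp hdp
  have hgF : p (p v) ∈ F := hF (p v) hpF hpr (p (p v)) hpg hdg
  have hgS : SD (p (p v)) := hSD₂ (p v) (p (p v)) hpg hpS
  have hvGC : v ∈ GC (p (p v)) :=
    (hGC _ v).2 ⟨p v, ⟨hpg.symm, by omega, hpF⟩, hvp.symm, by omega, hRF hvR⟩
  exact ⟨p (p v), hRup _ hgF hgS v hvGC hvR, hvGC, by omega⟩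

/-- Region vertices sit at EVEN distance from the root. [cite: Serre1980Trees, I.2.3] -/
theorem even_dist_of_mem_region (hT : G.IsTree) (r : V) (F : Set V)
    (hF : ∀ w ∈ F, w ≠ r → ∀ u, G.Adj w u → G.dist r u + 1 = G.dist r w → u ∈ F) (SD : V → Prop)
    (hSD₁ : ∀ v c, G.Adj v c → SD v → ¬ SD c) (hSD₂ : ∀ c w, G.Adj c w → ¬ SD c → SD w) (GC : V → Set V)
    (hGC : ∀ v w, w ∈ GC v ↔ ∃ c, (G.Adj v c ∧ G.dist r c = G.dist r v + 1 ∧ c ∈ F) ∧ (G.Adj c w ∧ G.dist r w = G.dist r c + 1 ∧ w ∈ F))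
    (R : Set V) (hrR : r ∈ R) (hRF : R ⊆ F) (hRS : ∀ v ∈ R, SD v) (hRup : ∀ v ∈ F, SD v → ∀ w ∈ GC v, w ∈ R → v ∈ R)
    {v : V} (hvR : v ∈ R) : Even (G.dist r v) := by
  suffices key : ∀ n (v : V), G.dist r v = n → v ∈ R → Even (G.dist r v) from key _ v rfl hvR
  intro n
  induction n using Nat.strong_induction_on with
  | _ n ih =>
  intro v hn hvR
  by_cases hvr : v = r
  · subst hvr; rw [SimpleGraph.dist_self]; exact ⟨0, rfl⟩
  · obtain ⟨g, hgR, -, hd⟩ := exists_gcParent_of_mem_region hT r F hF SD hSD₁ hSD₂ GC hGC R hrR hRF hRS hRup hvR hvr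
    obtain ⟨k, hk⟩ := ih (G.dist r g) (by omega) g rfl hgR
    exact ⟨k + 1, by omega⟩

/-- In a tree, the only vertex at distance `0` from the root is the root. [cite: Serre1980Trees, I.2.3] -/
theorem eq_root_of_dist_eq_zero (hT : G.IsTree) (r : V) {v : V} (hv : G.dist r v = 0) : v = r :=
  (((hT.1 r v).dist_eq_zero_iff).1 hv).symm

/-! ## §2 One layer from the previous one -/

/-- **THE LAYER RECURSION.**  The region vertices at distance `2j+2` are the disjoint union, over the region vertices `g` at distance `2j`, of the region grandchildren of `g`;
in cardinalities (Finset binders `L₁ ↔ {v ∈ R | dist = 2j+2}`, `L₀ ↔ {g ∈ R | dist = 2j}`, `sGR g ↔ GC g ∩ R`): `#L₁ = Σ_{g ∈ L₀} #(sGR g)`. [cite: Serre1980Trees, I.2.3] [cite: Kottwitz1986, §3] -/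
theorem card_regionLayer_succ_eq_sum (hT : G.IsTree) (r : V) (F : Set V)
    (hF : ∀ w ∈ F, w ≠ r → ∀ u, G.Adj w u → G.dist r u + 1 = G.dist r w → u ∈ F) (SD : V → Prop)
    (hSD₁ : ∀ v c, G.Adj v c → SD v → ¬ SD c) (hSD₂ : ∀ c w, G.Adj c w → ¬ SD c → SD w) (GC : V → Set V)
    (hGC : ∀ v w, w ∈ GC v ↔ ∃ c, (G.Adj v c ∧ G.dist r c = G.dist r v + 1 ∧ c ∈ F) ∧ (G.Adj c w ∧ G.dist r w = G.dist r c + 1 ∧ w ∈ F))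
    (R : Set V) (hrR : r ∈ R) (hRF : R ⊆ F) (hRS : ∀ v ∈ R, SD v) (hRup : ∀ v ∈ F, SD v → ∀ w ∈ GC v, w ∈ R → v ∈ R)
    (j : ℕ) (L₀ L₁ : Finset V) (hL₀ : ∀ v, v ∈ L₀ ↔ v ∈ R ∧ G.dist r v = 2 * j) (hL₁ : ∀ v, v ∈ L₁ ↔ v ∈ R ∧ G.dist r v = 2 * j + 2)
    (sGR : V → Finset V) (hsGR : ∀ g ∈ R, ∀ w, w ∈ sGR g ↔ w ∈ GC g ∧ w ∈ R) :
    L₁.card = ∑ g ∈ L₀, (sGR g).card := by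
  classical
  have hunion : L₁ = L₀.biUnion sGR := by
    ext v
    rw [hL₁, Finset.mem_biUnion]
    constructor
    · rintro ⟨hvR, hdv⟩
      have hvr : v ≠ r := by
        rintro rfl
        rw [SimpleGraph.dist_self] at hdv
        omega
      obtain ⟨g, hgR, hvg, hd⟩ := exists_gcParent_of_mem_region hT r F hF SD hSD₁ hSD₂ GC hGC R hrR hRF hRS hRup hvR hvr
      exact ⟨g, (hL₀ g).2 ⟨hgR, by omega⟩, (hsGR g hgR v).2 ⟨hvg, hvR⟩⟩
    · rintro ⟨g, hg, hv⟩
      obtain ⟨hgR, hdg⟩ := (hL₀ g).1 hg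
      obtain ⟨hvg, hvR⟩ := (hsGR g hgR v).1 hv
      obtain ⟨-, -, hd2, -⟩ := grandchild_mem_and_sd_and_dist hT r F SD hSD₁ hSD₂ GC hGC (hRS g hgR) hvg
      exact ⟨hvR, by omega⟩
  have hdisj : (L₀ : Set V).PairwiseDisjoint sGR := by
    intro g hg g' hg' hne
    rw [Finset.mem_coe] at hg hg'
    obtain ⟨hgR, hdg⟩ := (hL₀ g).1 hg
    obtain ⟨hg'R, hdg'⟩ := (hL₀ g').1 hg'
    have hD := disjoint_setOf_dist_of_ne hT r (c := g) (c' := g') (by rw [hdg, hdg']) hne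
    rw [Function.onFun, Finset.disjoint_left]
    intro w hw hw'
    obtain ⟨hwg, -⟩ := (hsGR g hgR w).1 hw
    obtain ⟨hwg', -⟩ := (hsGR g' hg'R w).1 hw'
    exact Set.disjoint_left.1 hD (grandchild_mem_and_sd_and_dist hT r F SD hSD₁ hSD₂ GC hGC (hRS g hgR) hwg).2.2.2
      (grandchild_mem_and_sd_and_dist hT r F SD hSD₁ hSD₂ GC hGC (hRS g' hg'R) hwg').2.2.2
  rw [hunion, Finset.card_biUnion hdisj]

/-! ## §3 Uniform branching: layer sizes and the total -/

/-- **LAYER SIZES UNDER UNIFORM BRANCHING.**  If the root has `b₀` region grandchildren and every region vertex `v ≠ r` with `dist r v < 2s` has `b` of them, then for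
`1 ≤ j ≤ s` the region has exactly `b₀·b^{j−1}` vertices at distance `2j` (isoceles axis: `2q·q^{j−1} = 2q^j`; `#END = 2q^s`). [cite: Serre1980Trees, I.2.3] [cite: Kottwitz1986, §3] -/
theorem ncard_regionLayer_eq_of_branching (hT : G.IsTree) (r : V) (F : Set V) (hFfin : F.Finite)
    (hF : ∀ w ∈ F, w ≠ r → ∀ u, G.Adj w u → G.dist r u + 1 = G.dist r w → u ∈ F) (SD : V → Prop)
    (hSD₁ : ∀ v c, G.Adj v c → SD v → ¬ SD c) (hSD₂ : ∀ c w, G.Adj c w → ¬ SD c → SD w) (GC : V → Set V)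
    (hGC : ∀ v w, w ∈ GC v ↔ ∃ c, (G.Adj v c ∧ G.dist r c = G.dist r v + 1 ∧ c ∈ F) ∧ (G.Adj c w ∧ G.dist r w = G.dist r c + 1 ∧ w ∈ F))
    (R : Set V) (hrR : r ∈ R) (hRF : R ⊆ F) (hRS : ∀ v ∈ R, SD v) (hRup : ∀ v ∈ F, SD v → ∀ w ∈ GC v, w ∈ R → v ∈ R)
    (s b₀ b : ℕ) (hroot : {w | w ∈ GC r ∧ w ∈ R}.ncard = b₀)
    (hint : ∀ v ∈ R, v ≠ r → G.dist r v < 2 * s → {w | w ∈ GC v ∧ w ∈ R}.ncard = b)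
    {j : ℕ} (hj1 : 1 ≤ j) (hjs : j ≤ s) :
    {v | v ∈ R ∧ G.dist r v = 2 * j}.ncard = b₀ * b ^ (j - 1) := by
  classical
  have hRfin : R.Finite := hFfin.subset hRF
  -- Finset avatars of the layers and of the region grandchildren
  set L : ℕ → Finset V := fun i => hRfin.toFinset.filter (fun v => G.dist r v = 2 * i) with hLdef
  have hL : ∀ i v, v ∈ L i ↔ v ∈ R ∧ G.dist r v = 2 * i := fun i v => by
    rw [hLdef, Finset.mem_filter, Set.Finite.mem_toFinset]
  set sGR : V → Finset V := fun g => hRfin.toFinset.filter (fun w => w ∈ GC g) with hsGRdef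
  have hsGR : ∀ g ∈ R, ∀ w, w ∈ sGR g ↔ w ∈ GC g ∧ w ∈ R := fun g _ w => by
    rw [hsGRdef, Finset.mem_filter, Set.Finite.mem_toFinset, and_comm]
  have hsGRcard : ∀ g ∈ R, (sGR g).card = {w | w ∈ GC g ∧ w ∈ R}.ncard := fun g hg => by
    have hset : {w | w ∈ GC g ∧ w ∈ R} = ↑(sGR g) := by
      ext w; rw [Finset.mem_coe, hsGR g hg]; rfl
    rw [hset, Set.ncard_coe_finset]
  have hLcard : ∀ i, (L i).card = {v | v ∈ R ∧ G.dist r v = 2 * i}.ncard := fun i => by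
    have hset : {v | v ∈ R ∧ G.dist r v = 2 * i} = ↑(L i) := by
      ext v; rw [Finset.mem_coe, hL i]; rfl
    rw [hset, Set.ncard_coe_finset]
  -- the root layer
  have hL0 : L 0 = {r} := by
    ext v
    rw [hL 0, Finset.mem_singleton, mul_zero]
    constructor
    · rintro ⟨-, hd⟩; exact eq_root_of_dist_eq_zero hT r hd
    · rintro rfl; exact ⟨hrR, SimpleGraph.dist_self⟩
  -- induction on `j ≥ 1`
  suffices key : ∀ i, 1 ≤ i → i ≤ s → (L i).card = b₀ * b ^ (i - 1) by rw [← hLcard]; exact key j hj1 hjs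
  intro i
  induction i with
  | zero => intro h; omega
  | succ i ih =>
    intro _ his
    rw [card_regionLayer_succ_eq_sum hT r F hF SD hSD₁ hSD₂ GC hGC R hrR hRF hRS hRup i (L i) (L (i + 1)) (hL i)
      (fun v => by rw [hL (i + 1), show 2 * (i + 1) = 2 * i + 2 by ring]) sGR hsGR]
    rcases Nat.eq_zero_or_pos i with hi0 | hipos
    · -- first layer: the root's region grandchildren
      subst hi0
      rw [hL0, Finset.sum_singleton, hsGRcard r hrR, hroot]
      simp
    · -- later layers: uniform branching `b` on the layer `i` (all at distance `2i < 2s`)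
      have hconst : ∀ g ∈ L i, (sGR g).card = b := by
        intro g hg
        obtain ⟨hgR, hdg⟩ := (hL i g).1 hg
        have hgr : g ≠ r := by rintro rfl; rw [SimpleGraph.dist_self] at hdg; omega
        rw [hsGRcard g hgR]
        exact hint g hgR hgr (by omega)
      rw [Finset.sum_congr rfl hconst, Finset.sum_const, smul_eq_mul, ih hipos (by omega),
        show i + 1 - 1 = (i - 1) + 1 by omega, pow_succ]
      ring

/-- **THE SIZE OF THE REGION UNDER UNIFORM BRANCHING**: with `dist r v ≤ 2s` on `R`, `#R = 1 + b₀·Σ_{i<s} bⁱ` (isoceles axis: `1 + 2q(1 + q + ⋯ + q^{s−1}) = 1 + 2q + ⋯ + 2q^s`,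
the `A` of ★ `kappaSum_isoceles_shared_pool`). [cite: Serre1980Trees, I.2.3] [cite: Kottwitz1986, §3] [cite: Rogawski1990, §4.9 pp. 54–56] -/
theorem ncard_region_eq_of_branching (hT : G.IsTree) (r : V) (F : Set V) (hFfin : F.Finite)
    (hF : ∀ w ∈ F, w ≠ r → ∀ u, G.Adj w u → G.dist r u + 1 = G.dist r w → u ∈ F) (SD : V → Prop)
    (hSD₁ : ∀ v c, G.Adj v c → SD v → ¬ SD c) (hSD₂ : ∀ c w, G.Adj c w → ¬ SD c → SD w) (GC : V → Set V)
    (hGC : ∀ v w, w ∈ GC v ↔ ∃ c, (G.Adj v c ∧ G.dist r c = G.dist r v + 1 ∧ c ∈ F) ∧ (G.Adj c w ∧ G.dist r w = G.dist r c + 1 ∧ w ∈ F))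
    (R : Set V) (hrR : r ∈ R) (hRF : R ⊆ F) (hRS : ∀ v ∈ R, SD v) (hRup : ∀ v ∈ F, SD v → ∀ w ∈ GC v, w ∈ R → v ∈ R)
    (s b₀ b : ℕ) (hroot : {w | w ∈ GC r ∧ w ∈ R}.ncard = b₀)
    (hint : ∀ v ∈ R, v ≠ r → G.dist r v < 2 * s → {w | w ∈ GC v ∧ w ∈ R}.ncard = b)
    (hmax : ∀ v ∈ R, G.dist r v ≤ 2 * s) :
    R.ncard = 1 + b₀ * ∑ i ∈ range s, b ^ i := by
  classical
  have hRfin : R.Finite := hFfin.subset hRF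
  -- `R` is the disjoint union of its layers `0, …, s`
  have hcover : hRfin.toFinset = (Finset.range (s + 1)).biUnion (fun i => hRfin.toFinset.filter (fun v => G.dist r v = 2 * i)) := by
    ext v
    rw [Finset.mem_biUnion, Set.Finite.mem_toFinset]
    constructor
    · intro hvR
      obtain ⟨k, hk⟩ := even_dist_of_mem_region hT r F hF SD hSD₁ hSD₂ GC hGC R hrR hRF hRS hRup hvR
      have hks : k ≤ s := by have := hmax v hvR; omega
      exact ⟨k, Finset.mem_range.2 (by omega), Finset.mem_filter.2 ⟨(Set.Finite.mem_toFinset _).2 hvR, by omega⟩⟩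
    · rintro ⟨i, -, hv⟩
      exact (Set.Finite.mem_toFinset _).1 (Finset.mem_filter.1 hv).1
  have hdisj : ((Finset.range (s + 1)) : Set ℕ).PairwiseDisjoint (fun i => hRfin.toFinset.filter (fun v => G.dist r v = 2 * i)) := by
    intro i _ i' _ hne
    rw [Function.onFun, Finset.disjoint_left]
    intro v hv hv'
    rw [Finset.mem_filter] at hv hv'
    omega
  rw [Set.ncard_eq_toFinset_card R hRfin, hcover, Finset.card_biUnion hdisj, Finset.sum_range_succ', Finset.mul_sum]
  -- layer `0` is `{r}`, layer `i+1` has `b₀ b^i` elements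
  have h0 : (hRfin.toFinset.filter (fun v => G.dist r v = 2 * 0)).card = 1 := by
    rw [Finset.card_eq_one]
    refine ⟨r, ?_⟩
    ext v
    rw [Finset.mem_filter, Set.Finite.mem_toFinset, Finset.mem_singleton, mul_zero]
    constructor
    · rintro ⟨-, hd⟩; exact eq_root_of_dist_eq_zero hT r hd
    · rintro rfl; exact ⟨hrR, SimpleGraph.dist_self⟩
  have hsucc : ∀ i ∈ Finset.range s, (hRfin.toFinset.filter (fun v => G.dist r v = 2 * (i + 1))).card = b₀ * b ^ i := by
    intro i hi
    rw [Finset.mem_range] at hi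
    have hset : {v | v ∈ R ∧ G.dist r v = 2 * (i + 1)} = ↑(hRfin.toFinset.filter (fun v => G.dist r v = 2 * (i + 1))) := by
      ext v; rw [Finset.coe_filter, Set.mem_setOf_eq, Set.mem_setOf_eq, Set.Finite.mem_toFinset]
    have h := ncard_regionLayer_eq_of_branching hT r F hFfin hF SD hSD₁ hSD₂ GC hGC R hrR hRF hRS hRup s b₀ b hroot hint (j := i + 1) (by omega) (by omega)
    rw [hset, Set.ncard_coe_finset, show i + 1 - 1 = i by omega] at h
    exact h
  rw [h0, Finset.sum_congr rfl hsucc, add_comm]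

/-! ## §4 Summing a type-dependent quantity over the region -/

/-- **THREE TYPES.**  If `f` takes the value `a₀` on the vertices of `sR` satisfying `P₀` (the ROOT), `a₂` on those satisfying `P₂ ∧ ¬P₀` (the END vertices) and `a₁` on the rest
(INTERIOR), then `Σ_{v ∈ sR} f v = #{P₀}•a₀ + #{¬P₀ ∧ ¬P₂}•a₁ + #{¬P₀ ∧ P₂}•a₂` — the pooling step between the per-vertex assembly ★ `strataVec_total_eq_of_localLaw_of_rootRegion_of_labels`
and the pooled algebra ★ `kappaSum_isoceles_shared_pool`. [cite: Kottwitz1986, §3] [cite: Rogawski1990, §4.9 pp. 54–56] -/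
theorem sum_eq_of_three_types {β : Type*} [AddCommMonoid β] (sR : Finset V) (P₀ P₂ : V → Prop) [DecidablePred P₀] [DecidablePred P₂]
    (f : V → β) (a₀ a₁ a₂ : β) (h₀ : ∀ v ∈ sR, P₀ v → f v = a₀) (h₁ : ∀ v ∈ sR, ¬ P₀ v → ¬ P₂ v → f v = a₁) (h₂ : ∀ v ∈ sR, ¬ P₀ v → P₂ v → f v = a₂) :
    ∑ v ∈ sR, f v =
      (sR.filter fun v => P₀ v).card • a₀ + (sR.filter fun v => ¬ P₀ v ∧ ¬ P₂ v).card • a₁ + (sR.filter fun v => ¬ P₀ v ∧ P₂ v).card • a₂ := by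
  classical
  rw [← Finset.sum_filter_add_sum_filter_not sR P₀, ← Finset.sum_filter_add_sum_filter_not (sR.filter fun v => ¬ P₀ v) P₂]
  have e₀ : ∑ v ∈ sR.filter (fun v => P₀ v), f v = (sR.filter fun v => P₀ v).card • a₀ := by
    rw [Finset.sum_congr rfl (fun v hv => h₀ v (Finset.mem_filter.1 hv).1 (Finset.mem_filter.1 hv).2), Finset.sum_const]
  have e₂ : ∑ v ∈ (sR.filter fun v => ¬ P₀ v).filter (fun v => P₂ v), f v = (sR.filter fun v => ¬ P₀ v ∧ P₂ v).card • a₂ := by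
    rw [Finset.filter_filter, Finset.sum_congr rfl (fun v hv => h₂ v (Finset.mem_filter.1 hv).1 (Finset.mem_filter.1 hv).2.1 (Finset.mem_filter.1 hv).2.2),
      Finset.sum_const]
  have e₁ : ∑ v ∈ (sR.filter fun v => ¬ P₀ v).filter (fun v => ¬ P₂ v), f v = (sR.filter fun v => ¬ P₀ v ∧ ¬ P₂ v).card • a₁ := by
    rw [Finset.filter_filter, Finset.sum_congr rfl (fun v hv => h₁ v (Finset.mem_filter.1 hv).1 (Finset.mem_filter.1 hv).2.1 (Finset.mem_filter.1 hv).2.2),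
      Finset.sum_const]
  rw [e₀, e₂, e₁]
  abel

/-- **THE THREE TYPE COUNTS OF THE REGION** under uniform branching (`dist ≤ 2s` on `R`, `1 ≤ s`): ROOT `1`, END `#{dist = 2s} = b₀ b^{s−1}`, INTERIOR `#R − 1 − b₀ b^{s−1}`
(in Finset currency for `sum_eq_of_three_types` with `P₀ := (· = r)`, `P₂ := (dist r · = 2s)`). [cite: Serre1980Trees, I.2.3] [cite: Kottwitz1986, §3] -/
theorem card_types_of_branching (hT : G.IsTree) (r : V) (F : Set V) (hFfin : F.Finite)
    (hF : ∀ w ∈ F, w ≠ r → ∀ u, G.Adj w u → G.dist r u + 1 = G.dist r w → u ∈ F) (SD : V → Prop)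
    (hSD₁ : ∀ v c, G.Adj v c → SD v → ¬ SD c) (hSD₂ : ∀ c w, G.Adj c w → ¬ SD c → SD w) (GC : V → Set V)
    (hGC : ∀ v w, w ∈ GC v ↔ ∃ c, (G.Adj v c ∧ G.dist r c = G.dist r v + 1 ∧ c ∈ F) ∧ (G.Adj c w ∧ G.dist r w = G.dist r c + 1 ∧ w ∈ F))
    (R : Set V) (hrR : r ∈ R) (hRF : R ⊆ F) (hRS : ∀ v ∈ R, SD v) (hRup : ∀ v ∈ F, SD v → ∀ w ∈ GC v, w ∈ R → v ∈ R)
    (s b₀ b : ℕ) (hs : 1 ≤ s) (hroot : {w | w ∈ GC r ∧ w ∈ R}.ncard = b₀)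
    (hint : ∀ v ∈ R, v ≠ r → G.dist r v < 2 * s → {w | w ∈ GC v ∧ w ∈ R}.ncard = b)
    (hmax : ∀ v ∈ R, G.dist r v ≤ 2 * s) (sR : Finset V) (hsR : ∀ v, v ∈ sR ↔ v ∈ R) [DecidableEq V] :
    (sR.filter fun v => v = r).card = 1 ∧ (sR.filter fun v => ¬ v = r ∧ G.dist r v = 2 * s).card = b₀ * b ^ (s - 1) ∧
      (sR.filter fun v => ¬ v = r ∧ ¬ G.dist r v = 2 * s).card + 1 + b₀ * b ^ (s - 1) = 1 + b₀ * ∑ i ∈ range s, b ^ i := by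
  classical
  have hroot1 : (sR.filter fun v => v = r).card = 1 := by
    rw [Finset.card_eq_one]
    exact ⟨r, by ext v; simp only [Finset.mem_filter, Finset.mem_singleton, hsR]; exact ⟨fun h => h.2, fun h => ⟨h ▸ hrR, h⟩⟩⟩
  have hend : (sR.filter fun v => ¬ v = r ∧ G.dist r v = 2 * s).card = b₀ * b ^ (s - 1) := by
    have hset : {v | v ∈ R ∧ G.dist r v = 2 * s} = ↑(sR.filter fun v => ¬ v = r ∧ G.dist r v = 2 * s) := by
      ext v
      simp only [Set.mem_setOf_eq, Finset.coe_filter, hsR]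
      constructor
      · rintro ⟨hvR, hd⟩
        refine ⟨hvR, ?_, hd⟩
        rintro rfl
        rw [SimpleGraph.dist_self] at hd
        omega
      · rintro ⟨hvR, -, hd⟩; exact ⟨hvR, hd⟩
    rw [← Set.ncard_coe_finset, ← hset]
    exact ncard_regionLayer_eq_of_branching hT r F hFfin hF SD hSD₁ hSD₂ GC hGC R hrR hRF hRS hRup s b₀ b hroot hint hs le_rfl
  have htot : sR.card = 1 + b₀ * ∑ i ∈ range s, b ^ i := by
    have hset : R = ↑sR := by ext v; rw [Finset.mem_coe, hsR]
    rw [← Set.ncard_coe_finset, ← hset]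
    exact ncard_region_eq_of_branching hT r F hFfin hF SD hSD₁ hSD₂ GC hGC R hrR hRF hRS hRup s b₀ b hroot hint hmax
  have hsplit : sR.card = (sR.filter fun v => v = r).card + ((sR.filter fun v => ¬ v = r ∧ ¬ G.dist r v = 2 * s).card +
      (sR.filter fun v => ¬ v = r ∧ G.dist r v = 2 * s).card) := by
    rw [← Finset.card_filter_add_card_filter_not (fun v => v = r), ← Finset.card_filter_add_card_filter_not (s := sR.filter fun v => ¬ v = r)
      (fun v => G.dist r v = 2 * s), Finset.filter_filter, Finset.filter_filter, add_comm ((sR.filter fun v => ¬ v = r ∧ G.dist r v = 2 * s).card)]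
  refine ⟨hroot1, hend, ?_⟩
  rw [← htot, hsplit, hroot1, hend]
  ring

end Literature.NumberTheory.Rogawski1990
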